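import Summits.Ventures.DiscreteObjects.PP12.NoPlanarOrderThreeCensus
import Summits.Ventures.DiscreteObjects.PP12.FixedPointsEqFixedLines

/-!
# PP(12): the exterior structure of a FLAG-type collineation (the live `|G| = 3` cell), kernel
Framing: lottery ticket; floor = certified bounds/negative ranges.

Cell pub-namedobj (venture DiscreteObjects), target (M), designs gen 11. After `order_three_structure_v2` (designs g10: the
planar case is Roth 1964, the elation case is Janko–van Trung 1981 in print) the live `|G| = 3` cell of a putative projective
plane of order 12 is the FLAG cell: a collineation `σ` whose fixed points all lie on a fixed line `l` and whose fixed lines all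
pass through a fixed point `c ∈ l` (`f = 1, 4, 7` or `10` fixed points). This file is the structural entry point of that cell,
for a general flag-type collineation of a finite projective plane (order `n`, no use of the order of `σ` unless stated):

* `exterior_iff_flag` — a point lies on no fixed line iff it is not `c` and the line `c·Q` is not fixed; so the EXTERIOR points
  are the points `≠ c` of the non-fixed lines through `c`, and `card_exterior_flag`: there are exactly `n · (n + 1 − g)` of them,
  `g` = number of fixed lines (order 12: `12 · (13 − g)`, i.e. `144, 108, 72, 36` for `g = 1, 4, 7, 10`);
* `exterior_on_line_flag` — a line through no fixed point (an EXTERIOR line) carries exactly `n + 1 − g` exterior points;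
* for `σ³ = 1` (`orbit_triangle`, `side_no_fixed_point`, `side_unique`): the orbit of an exterior point is a TRIANGLE, its sides
  are exterior lines, and a line contains the pair `{Q, σQ}` for at most one exterior `Q`;
* `exterior_line_is_side` — by Baer's equality (`fixedCard_points_eq_lines`) and the dual count, EVERY exterior line is a side
  `Q·σQ` of exactly one exterior orbit-triangle (so it meets one exterior orbit twice and `n − 1 − g` further orbits once each);
* (companion file `FlagSubcells`: the typed census statement `NoFlagOrder3Order12` of LiveCellsOrder3 is the conjunction of the
  four sub-cells `f ∈ {1, 4, 7, 10}`, fixed points = fixed lines = `f` by Baer's equality.)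
For `f = 10` an exterior line carries exactly `3` exterior points (`Q`, `σQ` and one 'odd' point of another orbit): this is
the entry point of the Latin-square reduction of the `f = 10` sub-cell (designs g10, FAMILY-P5PLANE §7). Elementary incidence
counting only; no `sorry`, no new axioms, no new definitions.
-/

namespace Summit.Ventures.DiscreteObjects.PP12

open Configuration Finset
open scoped Classical

namespace Collineation

variable {P L : Type*} [Membership P L] [ProjectivePlane P L] [Fintype P] [Fintype L]
  [DecidableEq P] [DecidableEq L] (σ : Collineation P L)

section Flag

variable {l : L} {c : P} (hl : σ.onLines l = l) (hc : σ.onPoints c = c) (hcl : c ∈ l)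
  (hP : ∀ p : P, σ.onPoints p = p → p ∈ l) (hL : ∀ m : L, σ.onLines m = m → c ∈ m)

omit [ProjectivePlane P L] [Fintype P] [Fintype L] [DecidableEq P] [DecidableEq L] in
include hl hP in
/-- In flag type, a point on no fixed line is not fixed. -/
theorem not_fixed_of_exterior_flag {Q : P} (hQ : ∀ m : L, σ.onLines m = m → Q ∉ m) : σ.onPoints Q ≠ Q :=
  fun e => hQ l hl (hP Q e)

omit [ProjectivePlane P L] [Fintype P] [Fintype L] [DecidableEq P] [DecidableEq L] in
include hl hcl hL in
/-- **Exterior points of a flag-type collineation.** `Q` lies on no fixed line iff `Q ≠ c` and no fixed line joins `c` to `Q`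
(all fixed lines pass through `c`): the exterior points are the points `≠ c` of the non-fixed lines through `c`. -/
theorem exterior_iff_flag (Q : P) :
    (∀ m : L, σ.onLines m = m → Q ∉ m) ↔ (Q ≠ c ∧ ∀ m : L, c ∈ m → Q ∈ m → σ.onLines m ≠ m) := by
  constructor
  · intro h
    exact ⟨fun e => h l hl (e ▸ hcl), fun m _ hQm hm => h m hm hQm⟩
  · rintro ⟨-, h⟩ m hm hQm
    exact h m (hL m hm) hQm hm

include hl hcl hP hL in
/-- **Number of exterior points: `n · (n + 1 − g)`**, `g` the number of fixed lines. (The non-fixed lines through `c` are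
`n + 1 − g` in number — every fixed line passes through `c` — and each carries `n` exterior points.) -/
theorem card_exterior_flag :
    (univ.filter fun Q : P => σ.onPoints Q ≠ Q ∧ ∀ m : L, σ.onLines m = m → Q ∉ m).card
      = ProjectivePlane.order P L * (ProjectivePlane.order P L + 1 - fixedCard σ.onLines) := by
  set X : Finset P := univ.filter fun Q : P => σ.onPoints Q ≠ Q ∧ ∀ m : L, σ.onLines m = m → Q ∉ m with hX
  set U : Finset L := univ.filter fun u : L => c ∈ u ∧ σ.onLines u ≠ u with hU
  -- |U| = (n+1) - g
  have hUcard : U.card = ProjectivePlane.order P L + 1 - fixedCard σ.onLines := by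
    have hall : (univ.filter fun u : L => c ∈ u).card = ProjectivePlane.order P L + 1 := by
      rw [← Fintype.card_subtype, ← Nat.card_eq_fintype_card]
      exact ProjectivePlane.lineCount_eq L c
    have hfix : ((univ.filter fun u : L => c ∈ u).filter fun u => σ.onLines u = u).card = fixedCard σ.onLines := by
      unfold fixedCard; congr 1; ext u
      simp only [mem_filter, mem_univ, true_and, and_iff_right_iff_imp]
      exact hL u
    have hsplit := Finset.card_filter_add_card_filter_not (s := univ.filter fun u : L => c ∈ u)
      (fun u : L => σ.onLines u = u)
    rw [hfix, hall, Finset.filter_filter] at hsplit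
    have e : (univ.filter fun u : L => c ∈ u ∧ ¬ σ.onLines u = u) = U := by rw [hU]
    rw [e] at hsplit
    omega
  -- the line c·Q of an exterior point
  let g : P → L := fun Q => if h : c ≠ Q then HasLines.mkLine h else l
  have hg : ∀ Q ∈ X, c ∈ g Q ∧ Q ∈ g Q ∧ σ.onLines (g Q) ≠ g Q := by
    intro Q hQ
    have hQ' := (Finset.mem_filter.mp hQ).2
    have hcQ : c ≠ Q := fun e => hQ'.2 l hl (e ▸ hcl)
    simp only [g, dif_pos hcQ]
    exact ⟨(HasLines.mkLine_ax hcQ).1, (HasLines.mkLine_ax hcQ).2,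
      fun hm => hQ'.2 _ hm (HasLines.mkLine_ax hcQ).2⟩
  have hmaps : ∀ Q ∈ X, g Q ∈ U := fun Q hQ => by
    simp only [hU, mem_filter, mem_univ, true_and]; exact ⟨(hg Q hQ).1, (hg Q hQ).2.2⟩
  have hfib : ∀ u ∈ U, (X.filter fun Q => g Q = u).card = ProjectivePlane.order P L := by
    intro u hu
    obtain ⟨hcu, hnu⟩ : c ∈ u ∧ σ.onLines u ≠ u := by simpa [hU] using hu
    have hset : (X.filter fun Q => g Q = u) = (univ.filter fun Q : P => Q ∈ u).erase c := by
      ext Q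
      simp only [mem_filter, mem_univ, true_and, Finset.mem_erase, hX]
      constructor
      · rintro ⟨hQX, hQu⟩
        have h := hg Q (by simpa [hX] using hQX)
        rw [hQu] at h
        exact ⟨fun e => hQX.2 l hl (e ▸ hcl), h.2.1⟩
      · rintro ⟨hQc, hQu⟩
        have hext : ∀ m : L, σ.onLines m = m → Q ∉ m := by
          intro m hm hQm
          have : m = u := ((Nondegenerate.eq_or_eq (hL m hm) hQm hcu hQu).resolve_left (Ne.symm hQc))
          exact hnu (this ▸ hm)
        have hQX : Q ∈ X := by
          simp only [hX, mem_filter, mem_univ, true_and]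
          exact ⟨σ.not_fixed_of_exterior_flag hl hP hext, hext⟩
        refine ⟨by simpa [hX] using hQX, ?_⟩
        have h := hg Q hQX
        exact ((Nondegenerate.eq_or_eq h.1 h.2.1 hcu hQu).resolve_left (Ne.symm hQc))
    have hall : (univ.filter fun Q : P => Q ∈ u).card = ProjectivePlane.order P L + 1 := by
      rw [← Fintype.card_subtype, ← Nat.card_eq_fintype_card]
      exact ProjectivePlane.pointCount_eq P u
    rw [hset, Finset.card_erase_of_mem (by simp [hcu]), hall]
    simp
  have hsum := Finset.card_eq_sum_card_fiberwise hmaps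
  rw [Finset.sum_congr rfl hfib, Finset.sum_const, hUcard, smul_eq_mul] at hsum
  rw [hsum, mul_comm]

include hl hcl hP hL hc in
/-- **Exterior points on an exterior line: `n + 1 − g`.** A line through no fixed point meets each non-fixed line through
`c` in an exterior point, and these are all its exterior points. -/
theorem exterior_on_line_flag {x : L} (hx : ∀ p : P, σ.onPoints p = p → p ∉ x) :
    (univ.filter fun Q : P => Q ∈ x ∧ σ.onPoints Q ≠ Q ∧ ∀ m : L, σ.onLines m = m → Q ∉ m).card
      = ProjectivePlane.order P L + 1 - fixedCard σ.onLines := by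
  set Xx : Finset P := univ.filter fun Q : P => Q ∈ x ∧ σ.onPoints Q ≠ Q ∧ ∀ m : L, σ.onLines m = m → Q ∉ m with hXx
  set U : Finset L := univ.filter fun u : L => c ∈ u ∧ σ.onLines u ≠ u with hU
  have hUcard : U.card = ProjectivePlane.order P L + 1 - fixedCard σ.onLines := by
    have hall : (univ.filter fun u : L => c ∈ u).card = ProjectivePlane.order P L + 1 := by
      rw [← Fintype.card_subtype, ← Nat.card_eq_fintype_card]
      exact ProjectivePlane.lineCount_eq L c
    have hfix : ((univ.filter fun u : L => c ∈ u).filter fun u => σ.onLines u = u).card = fixedCard σ.onLines := by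
      unfold fixedCard; congr 1; ext u
      simp only [mem_filter, mem_univ, true_and, and_iff_right_iff_imp]
      exact hL u
    have hsplit := Finset.card_filter_add_card_filter_not (s := univ.filter fun u : L => c ∈ u)
      (fun u : L => σ.onLines u = u)
    rw [hfix, hall, Finset.filter_filter] at hsplit
    have e : (univ.filter fun u : L => c ∈ u ∧ ¬ σ.onLines u = u) = U := by rw [hU]
    rw [e] at hsplit
    omega
  have hcx : c ∉ x := hx c hc
  -- u ↦ u ∩ x
  let ψ : L → P := fun u => if h : u ≠ x then HasPoints.mkPoint h else c
  have hψ : ∀ u ∈ U, ψ u ∈ u ∧ ψ u ∈ x := by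
    intro u hu
    obtain ⟨hcu, -⟩ : c ∈ u ∧ σ.onLines u ≠ u := by simpa [hU] using hu
    have hux : u ≠ x := fun e => hcx (e ▸ hcu)
    simp only [ψ, dif_pos hux]
    exact HasPoints.mkPoint_ax hux
  have hψmaps : ∀ u ∈ U, ψ u ∈ Xx := by
    intro u hu
    obtain ⟨hcu, hnu⟩ : c ∈ u ∧ σ.onLines u ≠ u := by simpa [hU] using hu
    obtain ⟨hRu, hRx⟩ := hψ u hu
    have hRc : ψ u ≠ c := fun e => hcx (e ▸ hRx)
    have hext : ∀ m : L, σ.onLines m = m → ψ u ∉ m := by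
      intro m hm hRm
      have : m = u := (Nondegenerate.eq_or_eq (hL m hm) hRm hcu hRu).resolve_left (Ne.symm hRc)
      exact hnu (this ▸ hm)
    simp only [hXx, mem_filter, mem_univ, true_and]
    exact ⟨hRx, σ.not_fixed_of_exterior_flag hl hP hext, hext⟩
  have hψinj : Set.InjOn ψ U := by
    intro u hu u' hu' heq
    obtain ⟨hcu, -⟩ : c ∈ u ∧ σ.onLines u ≠ u := by simpa [hU] using hu
    obtain ⟨hcu', -⟩ : c ∈ u' ∧ σ.onLines u' ≠ u' := by simpa [hU] using hu'
    obtain ⟨hRu, hRx⟩ := hψ u hu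
    obtain ⟨hRu', -⟩ := hψ u' hu'
    rw [← heq] at hRu'
    have hRc : ψ u ≠ c := fun e => hcx (e ▸ hRx)
    exact (Nondegenerate.eq_or_eq hcu hRu hcu' hRu').resolve_left hRc.symm
  -- Q ↦ c·Q backwards
  let g : P → L := fun Q => if h : c ≠ Q then HasLines.mkLine h else l
  have hg : ∀ Q ∈ Xx, c ∈ g Q ∧ Q ∈ g Q := by
    intro Q hQ
    have hQ' := (Finset.mem_filter.mp hQ).2
    have hcQ : c ≠ Q := fun e => hQ'.2.2 l hl (e ▸ hcl)
    simp only [g, dif_pos hcQ]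
    exact HasLines.mkLine_ax hcQ
  have hgmaps : ∀ Q ∈ Xx, g Q ∈ U := by
    intro Q hQ
    have hQ' := (Finset.mem_filter.mp hQ).2
    simp only [hU, mem_filter, mem_univ, true_and]
    exact ⟨(hg Q hQ).1, fun hm => hQ'.2.2 _ hm (hg Q hQ).2⟩
  have hginj : Set.InjOn g Xx := by
    intro Q hQ Q' hQ' heq
    have hQx : Q ∈ x := ((Finset.mem_filter.mp hQ).2).1
    have hQ'x : Q' ∈ x := ((Finset.mem_filter.mp hQ').2).1
    obtain ⟨hcg, hQg⟩ := hg Q hQ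
    obtain ⟨-, hQ'g⟩ := hg Q' hQ'
    rw [← heq] at hQ'g
    by_contra hne
    have : g Q = x := (Nondegenerate.eq_or_eq hQg hQ'g hQx hQ'x).resolve_left hne
    exact hcx (this ▸ hcg)
  have h1 := Finset.card_le_card_of_injOn ψ hψmaps hψinj
  have h2 := Finset.card_le_card_of_injOn g hgmaps hginj
  rw [hUcard] at h1 h2
  exact le_antisymm h2 h1

omit [ProjectivePlane P L] [Fintype P] [Fintype L] [DecidableEq P] [DecidableEq L] in
/-- `σ²Q ≠ Q` and `σ²Q ≠ σQ` for a non-fixed point of a collineation with `σ³ = 1`. -/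
theorem sq_ne_of_cube (hq : σ.onPoints ^ 3 = 1) {Q : P} (hQ : σ.onPoints Q ≠ Q) :
    σ.onPoints (σ.onPoints Q) ≠ Q ∧ σ.onPoints (σ.onPoints Q) ≠ σ.onPoints Q := by
  have h3 : σ.onPoints (σ.onPoints (σ.onPoints Q)) = Q := by
    have := congrArg (fun τ : Equiv.Perm P => τ Q) hq
    simpa [pow_succ, Equiv.Perm.mul_apply] using this
  refine ⟨fun e => hQ ?_, fun e => hQ (σ.onPoints.injective e)⟩
  have := congrArg σ.onPoints e
  rw [h3] at this
  exact this.symm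

omit [Fintype P] [Fintype L] [DecidableEq P] [DecidableEq L] in
/-- **Exterior orbits are triangles** (`σ³ = 1`): the three points `Q, σQ, σ²Q` of an exterior orbit are pairwise distinct and
not collinear (a line through all three would be fixed). -/
theorem orbit_triangle (hq : σ.onPoints ^ 3 = 1) {Q : P} (hQ : σ.onPoints Q ≠ Q)
    (hQX : ∀ m : L, σ.onLines m = m → Q ∉ m) :
    σ.onPoints Q ≠ Q ∧ σ.onPoints (σ.onPoints Q) ≠ Q ∧ σ.onPoints (σ.onPoints Q) ≠ σ.onPoints Q ∧
    ∀ m : L, Q ∈ m → σ.onPoints Q ∈ m → σ.onPoints (σ.onPoints Q) ∉ m := by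
  refine ⟨hQ, (σ.sq_ne_of_cube hq hQ).1, (σ.sq_ne_of_cube hq hQ).2, fun m hQm hσQm hσσQm => ?_⟩
  have h3 : σ.onPoints (σ.onPoints (σ.onPoints Q)) = Q := by
    have := congrArg (fun τ : Equiv.Perm P => τ Q) hq
    simpa [pow_succ, Equiv.Perm.mul_apply] using this
  -- σ m contains σQ and σ²Q … and Q = σ³Q; so σ m = m
  have h1 : σ.onPoints Q ∈ σ.onLines m := σ.mem_map hQm
  have h2 : σ.onPoints (σ.onPoints Q) ∈ σ.onLines m := σ.mem_map hσQm
  have hm : m = σ.onLines m :=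
    (Nondegenerate.eq_or_eq hσQm hσσQm h1 h2).resolve_left (σ.sq_ne_of_cube hq hQ).2.symm
  exact hQX m hm.symm hQm

omit [Fintype P] [Fintype L] [DecidableEq P] [DecidableEq L] in
/-- **A line through `Q` and `σQ`, `Q` exterior, is not fixed and carries no fixed point** (its sides are exterior lines). -/
theorem side_no_fixed_point {Q : P} (hQ : σ.onPoints Q ≠ Q) (hQX : ∀ m : L, σ.onLines m = m → Q ∉ m)
    {m : L} (hQm : Q ∈ m) (hσQm : σ.onPoints Q ∈ m) :
    σ.onLines m ≠ m ∧ ∀ y : P, σ.onPoints y = y → y ∉ m := by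
  have hnm : σ.onLines m ≠ m := fun hm => hQX m hm hQm
  refine ⟨hnm, fun y hy hym => ?_⟩
  have hyσQ : y ≠ σ.onPoints Q := by
    intro e; apply hQ
    have : σ.onPoints (σ.onPoints Q) = σ.onPoints Q := by rw [← e]; exact hy
    exact σ.onPoints.injective this
  have h1 : σ.onPoints Q ∈ σ.onLines m := σ.mem_map hQm
  have h2 : y ∈ σ.onLines m := by have := σ.mem_map hym; rwa [hy] at this
  exact hnm ((Nondegenerate.eq_or_eq hym hσQm h2 h1).resolve_left hyσQ).symm

omit [Fintype P] [Fintype L] [DecidableEq P] [DecidableEq L] in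
/-- **A line is a side of at most one exterior orbit:** if a line contains `Q, σQ` (`Q` exterior) and `R, σR`, then `R = Q`. -/
theorem side_unique {Q R : P} (hQX : ∀ m : L, σ.onLines m = m → Q ∉ m) {m : L} (hQm : Q ∈ m)
    (hσQm : σ.onPoints Q ∈ m) (hRm : R ∈ m) (hσRm : σ.onPoints R ∈ m) : R = Q := by
  by_contra hne
  have hne' : σ.onPoints R ≠ σ.onPoints Q := fun e => hne (σ.onPoints.injective e)
  have h1 : σ.onPoints Q ∈ σ.onLines m := σ.mem_map hQm
  have h2 : σ.onPoints R ∈ σ.onLines m := σ.mem_map hRm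
  have hm : m = σ.onLines m := (Nondegenerate.eq_or_eq hσRm hσQm h2 h1).resolve_left hne'
  exact hQX m hm.symm hQm

include hc hcl hP hL in
/-- **Number of exterior lines: `n · (n + 1 − f)`**, `f` the number of fixed points (the dual count). -/
theorem card_exterior_lines_flag :
    (univ.filter fun x : L => σ.onLines x ≠ x ∧ ∀ p : P, σ.onPoints p = p → p ∉ x).card
      = ProjectivePlane.order P L * (ProjectivePlane.order P L + 1 - fixedCard σ.onPoints) := by
  have h := σ.dual.card_exterior_flag (l := (c : Dual P)) (c := (l : Dual L)) hc hcl hL hP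
  rw [ProjectivePlane.Dual.order] at h
  exact h

include hl hc hcl hP hL in
/-- **Every exterior line is a side of an exterior orbit:** a non-fixed line through no fixed point contains `Q` and `σQ` for
some exterior point `Q` (unique by `side_unique`; no hypothesis on the order of `σ`). Proof: `Q ↦ Q·σQ` is injective from
exterior points to exterior lines, and both sets have `n (n + 1 − f)` elements by Baer's equality `f = g`. -/
theorem exterior_line_is_side {x : L} (hnx : σ.onLines x ≠ x)
    (hx : ∀ p : P, σ.onPoints p = p → p ∉ x) :
    ∃ Q : P, (σ.onPoints Q ≠ Q ∧ ∀ m : L, σ.onLines m = m → Q ∉ m) ∧ Q ∈ x ∧ σ.onPoints Q ∈ x := by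
  set X : Finset P := univ.filter fun Q : P => σ.onPoints Q ≠ Q ∧ ∀ m : L, σ.onLines m = m → Q ∉ m with hX
  set EL : Finset L := univ.filter fun y : L => σ.onLines y ≠ y ∧ ∀ p : P, σ.onPoints p = p → p ∉ y with hEL
  have hcard : X.card = EL.card := by
    rw [hX, hEL, σ.card_exterior_flag hl hcl hP hL, σ.card_exterior_lines_flag hc hcl hP hL,
      σ.fixedCard_points_eq_lines]
  let s : P → L := fun Q => if h : Q ≠ σ.onPoints Q then HasLines.mkLine h else l
  have hs : ∀ Q ∈ X, Q ∈ s Q ∧ σ.onPoints Q ∈ s Q := by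
    intro Q hQ
    have hQ' : σ.onPoints Q ≠ Q := ((Finset.mem_filter.mp hQ).2).1
    simp only [s, dif_pos hQ'.symm]
    exact HasLines.mkLine_ax hQ'.symm
  have hsmaps : ∀ Q ∈ X, s Q ∈ EL := by
    intro Q hQ
    obtain ⟨hQ1, hQ2⟩ : σ.onPoints Q ≠ Q ∧ ∀ m : L, σ.onLines m = m → Q ∉ m := by simpa [hX] using hQ
    have h := σ.side_no_fixed_point hQ1 hQ2 (hs Q hQ).1 (hs Q hQ).2
    simp only [hEL, mem_filter, mem_univ, true_and]
    exact h
  have hsinj : Set.InjOn s X := by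
    intro Q hQ R hR heq
    obtain ⟨-, hQ2⟩ : σ.onPoints Q ≠ Q ∧ ∀ m : L, σ.onLines m = m → Q ∉ m := by simpa [hX] using hQ
    have h1 := hs Q hQ
    have h2 := hs R hR
    rw [← heq] at h2
    exact (σ.side_unique hQ2 h1.1 h1.2 h2.1 h2.2).symm
  have himg : X.image s = EL := by
    apply Finset.eq_of_subset_of_card_le
    · intro y hy
      obtain ⟨Q, hQ, rfl⟩ := Finset.mem_image.mp hy
      exact hsmaps Q hQ
    · rw [Finset.card_image_of_injOn hsinj, hcard]
  have hxEL : x ∈ X.image s := by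
    rw [himg]; exact Finset.mem_filter.mpr ⟨Finset.mem_univ _, hnx, hx⟩
  obtain ⟨Q, hQ, hQx⟩ := Finset.mem_image.mp hxEL
  refine ⟨Q, by simpa [hX] using hQ, ?_, ?_⟩
  · rw [← hQx]; exact (hs Q hQ).1
  · rw [← hQx]; exact (hs Q hQ).2

include hl hc hcl hP hL in
/-- **Order 12, `f = 10`:** every exterior line carries exactly three exterior points — `Q`, `σQ` for a unique exterior orbit, and
one further exterior point of a different orbit (the 'odd point' of the Latin-square reduction of the `f = 10` sub-cell). -/
theorem exterior_line_three_of_flag_ten (h12 : ProjectivePlane.order P L = 12) (hq : σ.onPoints ^ 3 = 1)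
    (hf : fixedCard σ.onPoints = 10) {x : L} (hnx : σ.onLines x ≠ x) (hx : ∀ p : P, σ.onPoints p = p → p ∉ x) :
    (univ.filter fun Q : P => Q ∈ x ∧ σ.onPoints Q ≠ Q ∧ ∀ m : L, σ.onLines m = m → Q ∉ m).card = 3 ∧
    ∃ Q R : P, (σ.onPoints Q ≠ Q ∧ ∀ m : L, σ.onLines m = m → Q ∉ m) ∧ Q ∈ x ∧ σ.onPoints Q ∈ x ∧
      (σ.onPoints R ≠ R ∧ ∀ m : L, σ.onLines m = m → R ∉ m) ∧ R ∈ x ∧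
      R ≠ Q ∧ R ≠ σ.onPoints Q ∧ R ≠ σ.onPoints (σ.onPoints Q) := by
  have hcount := σ.exterior_on_line_flag hl hc hcl hP hL hx
  rw [h12, ← σ.fixedCard_points_eq_lines, hf] at hcount
  norm_num at hcount
  refine ⟨hcount, ?_⟩
  obtain ⟨Q, hQ, hQx, hσQx⟩ := σ.exterior_line_is_side hl hc hcl hP hL hnx hx
  set Xx : Finset P := univ.filter fun Q : P => Q ∈ x ∧ σ.onPoints Q ≠ Q ∧ ∀ m : L, σ.onLines m = m → Q ∉ m with hXx
  -- remove Q and σQ: one point R remains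
  have hQmem : Q ∈ Xx := Finset.mem_filter.mpr ⟨Finset.mem_univ _, hQx, hQ.1, hQ.2⟩
  have hσQX : σ.onPoints (σ.onPoints Q) ≠ σ.onPoints Q ∧ ∀ m : L, σ.onLines m = m → σ.onPoints Q ∉ m := by
    refine ⟨(σ.sq_ne_of_cube hq hQ.1).2, fun m hm hσQm => hQ.2 m hm ?_⟩
    exact (σ.mem_fixedLine_iff hm Q).mp hσQm
  have hσQmem : σ.onPoints Q ∈ Xx := Finset.mem_filter.mpr ⟨Finset.mem_univ _, hσQx, hσQX.1, hσQX.2⟩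
  have h2 : ((Xx.erase Q).erase (σ.onPoints Q)).card = 1 := by
    rw [Finset.card_erase_of_mem (Finset.mem_erase.mpr ⟨hQ.1, hσQmem⟩), Finset.card_erase_of_mem hQmem, hcount]
  obtain ⟨R, hR⟩ := Finset.card_eq_one.mp h2
  have hRmem : R ∈ (Xx.erase Q).erase (σ.onPoints Q) := by rw [hR]; simp
  simp only [Finset.mem_erase, hXx, mem_filter, mem_univ, true_and] at hRmem
  obtain ⟨hRσQ, hRQ, hRx, hR1, hR2⟩ := hRmem
  refine ⟨Q, R, hQ, hQx, hσQx, ⟨hR1, hR2⟩, hRx, hRQ, hRσQ, ?_⟩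
  exact (σ.orbit_triangle hq hQ.1 hQ.2).2.2.2 x hQx hσQx ∘ fun e => e ▸ hRx

end Flag

end Collineation

/-- **Exterior count in the four sub-cells (order 12):** a flag-type collineation with `f` fixed points has exactly
`12 · (13 − f)` exterior points, i.e. `144, 108, 72, 36` for `f = 1, 4, 7, 10`. -/
theorem Collineation.card_exterior_flag_order12 {P L : Type*} [Membership P L] [ProjectivePlane P L] [Fintype P]
    [Fintype L] [DecidableEq P] [DecidableEq L] (σ : Collineation P L) (h12 : ProjectivePlane.order P L = 12)
    {l : L} {c : P} (hl : σ.onLines l = l) (hcl : c ∈ l) (hP : ∀ p : P, σ.onPoints p = p → p ∈ l)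
    (hL : ∀ m : L, σ.onLines m = m → c ∈ m) :
    (univ.filter fun Q : P => σ.onPoints Q ≠ Q ∧ ∀ m : L, σ.onLines m = m → Q ∉ m).card
      = 12 * (13 - fixedCard σ.onPoints) := by
  rw [σ.card_exterior_flag hl hcl hP hL, h12, σ.fixedCard_points_eq_lines]

end Summit.Ventures.DiscreteObjects.PP12
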